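import Mathlib

/-!
# T5AveragingProjection — two Hilbert-space sentences of N4.3 v12 (A3) STEPS 3–4

Kernel witnesses (seat p5, cell pub-hodge-repro2, Tier 5) for two elementary sentences of the
print-status addendum `route/T5-N4-p5.md` v12 (A3):

* STEP 3 (γ) «the `K_f`-average `e_{K_f} f` satisfies `‖e_{K_f} f − f‖ ≤ sup_{k ∈ K_f} ‖R(k)f − f‖`» —
  `norm_average_sub_le`: for a probability measure `μ` and an integrable `g` with `‖g k − f‖ ≤ C`
  for every `k`, `‖∫ g dμ − f‖ ≤ C` (Bochner integral; the bound of Mathlib's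
  `norm_integral_le_of_norm_le_const`);
* STEP 4 «`P_π` commutes with `R(G(𝔸))` (`L_π` is `G(𝔸)`-stable and closed)», i.e. [Bo72] 5.4
  (i) ⇒ (iii) — `starProjection_comm_of_invariant`: if a unitary operator `U` (a linear isometry
  equivalence) and its inverse preserve a closed subspace `W` of a Hilbert space, then the orthogonal
  projection onto `W` commutes with `U`; `starProjection_comm_of_invariant_apply` is the pointwise
  form, and `orthogonal_invariant_of_invariant` the auxiliary «`U` preserves `Wᗮ`».

Nothing about groups, Haar measures or representations is asserted; a unitary representation
enters only through one operator `U` at a time (the hypothesis «`U⁻¹ W ⊆ W`» is what the group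
supplies, via `g⁻¹`).
-/

namespace Summit.Ventures.HodgeRepro2.T5AveragingProjection

section Averaging

open MeasureTheory

variable {K : Type*} [MeasurableSpace K] {E : Type*} [NormedAddCommGroup E] [NormedSpace ℝ E]
  [CompleteSpace E]

/-- STEP 3 (γ): an average against a probability measure moves `f` by at most the uniform bound
on `‖g k − f‖`. -/
theorem norm_average_sub_le (μ : Measure K) [IsProbabilityMeasure μ] {g : K → E}
    (hg : Integrable g μ) (f : E) {C : ℝ} (h : ∀ k, ‖g k - f‖ ≤ C) :
    ‖(∫ k, g k ∂μ) - f‖ ≤ C := by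
  have hf : Integrable (fun _ : K => f) μ := integrable_const f
  have h1 : (∫ k, g k ∂μ) - f = ∫ k, (g k - f) ∂μ := by
    rw [integral_sub hg hf, integral_const, probReal_univ, one_smul]
  rw [h1]
  have := norm_integral_le_of_norm_le_const (μ := μ) (f := fun k => g k - f) (C := C)
    (Filter.Eventually.of_forall h)
  rwa [probReal_univ, mul_one] at this

end Averaging

section Projection

variable {𝕜 E : Type*} [RCLike 𝕜] [NormedAddCommGroup E] [InnerProductSpace 𝕜 E]

/-- If a unitary `U` and its inverse preserve `W`, then `U` preserves `Wᗮ`. -/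
theorem orthogonal_invariant_of_invariant (W : Submodule 𝕜 E) (U : E ≃ₗᵢ[𝕜] E)
    (hW' : ∀ w ∈ W, U.symm w ∈ W) {z : E} (hz : z ∈ Wᗮ) : U z ∈ Wᗮ := by
  rw [Submodule.mem_orthogonal] at hz ⊢
  intro w hw
  have := hz (U.symm w) (hW' w hw)
  rwa [← U.inner_map_map, U.apply_symm_apply] at this

/-- STEP 4 / [Bo72] 5.4 (i) ⇒ (iii), pointwise: the orthogonal projection onto a closed subspace
preserved by the unitary `U` and by `U⁻¹` commutes with `U`. -/
theorem starProjection_comm_of_invariant_apply (W : Submodule 𝕜 E) [W.HasOrthogonalProjection]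
    (U : E ≃ₗᵢ[𝕜] E) (hW : ∀ w ∈ W, U w ∈ W) (hW' : ∀ w ∈ W, U.symm w ∈ W) (v : E) :
    W.starProjection (U v) = U (W.starProjection v) := by
  apply Submodule.eq_starProjection_of_mem_orthogonal
  · exact hW _ (W.starProjection_apply_mem v)
  · rw [← map_sub]
    exact orthogonal_invariant_of_invariant W U hW' (W.sub_starProjection_mem_orthogonal v)

/-- STEP 4 / [Bo72] 5.4 (i) ⇒ (iii), as an identity of operators: `P_W ∘ U = U ∘ P_W`. -/
theorem starProjection_comm_of_invariant (W : Submodule 𝕜 E) [W.HasOrthogonalProjection]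
    (U : E ≃ₗᵢ[𝕜] E) (hW : ∀ w ∈ W, U w ∈ W) (hW' : ∀ w ∈ W, U.symm w ∈ W) :
    (W.starProjection : E →L[𝕜] E).comp (U : E →L[𝕜] E) =
      (U : E →L[𝕜] E).comp W.starProjection := by
  ext v
  exact starProjection_comm_of_invariant_apply W U hW hW' v

/-- The restriction of the projection identity to `W` itself: `U` maps the fibre `v − P_W v` of `v`
(the `Wᗮ`-component) to the `Wᗮ`-component of `U v`. -/
theorem sub_starProjection_map (W : Submodule 𝕜 E) [W.HasOrthogonalProjection]
    (U : E ≃ₗᵢ[𝕜] E) (hW : ∀ w ∈ W, U w ∈ W) (hW' : ∀ w ∈ W, U.symm w ∈ W) (v : E) :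
    U v - W.starProjection (U v) = U (v - W.starProjection v) := by
  rw [starProjection_comm_of_invariant_apply W U hW hW', map_sub]

end Projection

end Summit.Ventures.HodgeRepro2.T5AveragingProjection
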